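import Literature.AnabelianGeometry.AbsoluteAnabelian.AbsTopIProp410CoFreeBridge
import Literature.AnabelianGeometry.AbsoluteAnabelian.AbsTopIProp410SubRows
import Literature.AnabelianGeometry.AbsoluteAnabelian.AbsTopIProp410DenseProofs
import Literature.AnabelianGeometry.AbsoluteAnabelian.AbsTopI.CoFreeCompletionComparisonTop
import Literature.AnabelianGeometry.SemiGraphs.TemperedDLocTransport
import HarnessLib

/-!
# [AbsTopI] Prop 4.10 (iii) AT THE CONSTRUCTION, assembled from its rows ("follows immediately
# from (i)", p. 61) — proof-only

S. Mochizuki, *Topics in Absolute Anabelian Geometry I: Generalities* [AbsTopI] (J. Math. Sci.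
Univ. Tokyo 19 (2012)), Prop 4.10 (iii) p. 60 and proof p. 61 (manuscript pagination, lit key
`paper:url-11ac98ba15fc`, read on the page): "Assertion (iii) follows immediately from assertion
(i)."  Kernel form of that sentence for the node `Prop410iiiAt E` (abc-iut-L4-t13 gen 3's
`AbsTopIProp410CoFreeBridge.lean`, over abc-iut-w5-d025's sub-DAG `AbsTopIProp410Sub.lean`), via
the generic comparison `AbsTopI/CoFreeCompletionComparison(Top).lean` (gen 4):

`prop410iiiAt_of_rows`: `SelfCompletionAt Y` ((i) for `Y`) + `CoFreeCofinalImAlong E` (both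
cofinality directions; conj. 1 EXPECTED-TRUE per decider abc-iut-w5-d208 2026-08-26T03:28:45Z) +
IMAGE AGREEMENT ("`Π^tp_Y = f(Π^tp_X)` modulo the X-side co-free kernels", the honest residue of
row iii.L03) + OPENNESS of the descended maps `f̄_H` (open mapping theorem situation) ⟹
`Prop410iiiAt E`.  Inputs are hypotheses stated in the signature (no new named facts).
`imageAgreement_of` REDUCES image agreement to printed-shape inputs: same Galois image of `X` and `Y`
(both lie over `k`), DENSITY of `Δ^tp_X → Δ^tp_Y` (Def 4.11 (i)(c) "dense homomorphism", Δ-level),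
§0 p. 8's standing hypothesis "every characteristic open subgroup of finite index `H ⊆ Δ` admits a
minimal co-free subgroup `H^{co-fr} ⊆ H`" (for `Δ^tp_Y`; it makes `H′^{co-fr}` OPEN, so a dense
image fills the discrete `Δ^tp_Y / H′^{co-fr}`), and the converse cofinality choice; whence
`prop410iiiAt_of_rows'`.  Consistency: `Prop410iiiDelta.denseRange_fDelta` — the Δ-level density
input is itself FORCED by the node "(iii) for `Δ^tp`" at any kit.
HONEST FRAMING: refereed prerequisite paper; typed ≠ proved for the inputs; nothing here bears on
[IUTchIII] Cor 3.12.
-/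

noncomputable section

open Topology

namespace Literature.AnabelianGeometry.AbsoluteAnabelian.AbsTopI.Prop410

open Literature.AnabelianGeometry.SemiGraphs
open Literature.AnabelianGeometry.AbsoluteAnabelian.AbsTopI

variable {p : ℕ} [Fact p.Prime]

/-- Compatibility `toHat_Y ∘ f = f̂ ∘ toHat_X` in the shape the comparison wants
(`ρY ∘ f = ρX` with `ρX := f̂ ∘ toHat_X`, `ρY := id ∘ toHat_Y`). [cite: MochizukiAbsTopI2012, Prop 4.10 (iii) p.60] -/
theorem DeCuspidalization.compat {X Y : TemperedCurve p} (E : DeCuspidalization X Y) (g : X.PiTemp) :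
    ((ContinuousMonoidHom.id Y.PiHat).comp Y.toHat) (E.f g) = (E.fHat.comp X.toHat) g :=
  E.toHat_comp g

/-- **[AbsTopI] Prop 4.10 (iii) at the construction, from its rows** ("follows immediately from
(i)", p. 61): (i) for `Y` (`SelfCompletionAt Y`), cofinality of the two kernel families in `Π̂_Y`
(`CoFreeCofinalImAlong E`), image agreement modulo the co-free kernels, and openness of the descended
maps `Π^tp_X ⧸ K_H → Π^tp_Y ⧸ K^Y_H` ⟹ an isomorphism `(Π^tp_X)^{Π̂_Y/co-fr} ≃ₜ* Π^tp_Y` carrying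
the natural map to `f`, i.e. `Prop410iiiAt E`. [cite: MochizukiAbsTopI2012, Prop 4.10 (iii) p.60] -/
theorem prop410iiiAt_of_rows {X Y : TemperedCurve p} (E : DeCuspidalization X Y)
    (hY : SelfCompletionAt Y) (hcof : CoFreeCofinalImAlong E)
    (hIA : ∀ (H : CharOpenSubgroup X.DeltaTemp) (q : Y.PiTemp), ∃ g : X.PiTemp,
      ((((ContinuousMonoidHom.id Y.PiHat).comp Y.toHat) q : Y.PiHat) :
          CoFreeQuot (E.fHat.comp X.toHat) H.toSubgroup) =
        toCoFreeQuot (E.fHat.comp X.toHat) H.toSubgroup g)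
    (hopen : ∀ H : CharOpenSubgroup X.DeltaTemp,
      IsOpenMap (fbar (ρX := E.fHat.comp X.toHat)
        (ρY := (ContinuousMonoidHom.id Y.PiHat).comp Y.toHat) (ΔX := X.DeltaTemp) (f := E.f)
        E.compat H)) :
    Prop410iiiAt E := by
  classical
  -- the two cofinality choices
  choose d hd using hcof.1
  choose c hc using hcof.2
  -- (i) for `Y`
  obtain ⟨eY, heY⟩ := hY
  exact exists_equiv_toCoFreeCompletion_eq (ΔY := Y.DeltaTemp) E.compat c hc d hd hIA hopen eY heY


/-! ### Image agreement from density and §0's minimal-co-free hypothesis -/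

/-- An open subgroup of an open subgroup: if `M ⊆ H′ ⊆ Δ` with `M` open in `H′` and `H′` open in
`Δ` (subspace topologies from `Π`), then `M` is open in `Δ`. [cite: MochizukiAbsTopI2012, §0 p.8] -/
theorem isOpen_subgroupOf_of_isOpen_subgroupOf {P : Type*} [Group P] [TopologicalSpace P]
    {Δ H' M : Subgroup P} (hMH : M ≤ H') (hH : IsOpen ((H'.subgroupOf Δ : Subgroup Δ) : Set Δ))
    (hM : IsOpen ((M.subgroupOf H' : Subgroup H') : Set H')) :
    IsOpen ((M.subgroupOf Δ : Subgroup Δ) : Set Δ) := by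
  obtain ⟨V, hV, hVM⟩ := isOpen_induced_iff.mp hM
  obtain ⟨W, hW, hWH⟩ := isOpen_induced_iff.mp hH
  have hset : ((M.subgroupOf Δ : Subgroup Δ) : Set Δ) = Subtype.val ⁻¹' (W ∩ V) := by
    ext δ
    constructor
    · intro hδ
      have hδM : (δ : P) ∈ M := hδ
      have hδH : (δ : P) ∈ H' := hMH hδM
      refine ⟨?_, ?_⟩
      · have : δ ∈ (Subtype.val ⁻¹' W : Set Δ) := by
          rw [hWH]; exact hδH
        exact this
      · have : (⟨(δ : P), hδH⟩ : H') ∈ (Subtype.val ⁻¹' V : Set H') := by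
          rw [hVM]; exact hδM
        exact this
    · rintro ⟨hδW, hδV⟩
      have hδH : (δ : P) ∈ H' := by
        have : δ ∈ (Subtype.val ⁻¹' W : Set Δ) := hδW
        rw [hWH] at this; exact this
      have : (⟨(δ : P), hδH⟩ : H') ∈ (Subtype.val ⁻¹' V : Set H') := hδV
      rw [hVM] at this
      exact this
  rw [hset]
  exact (hW.inter hV).preimage continuous_subtype_val

/-- Under §0's standing hypothesis ("`H′` admits a minimal co-free subgroup"), `H′^{co-fr} = cofreeCore H′`
is OPEN in `Δ` for an index `H′` (co-free ⟹ open in `H′`, and `H′` is open in `Δ`).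
[cite: MochizukiAbsTopI2012, §0 p.8] -/
theorem isOpen_cofreeCore_subgroupOf {P : Type*} [Group P] [TopologicalSpace P] {Δ : Subgroup P}
    (H' : CharOpenSubgroup Δ) {M : Subgroup P} (hM : IsMinimalCofreeIn H'.toSubgroup M) :
    IsOpen (((cofreeCore H'.toSubgroup).subgroupOf Δ : Subgroup Δ) : Set Δ) := by
  rw [cofreeCore_eq_of_isMinimalCofreeIn hM]
  obtain ⟨hle, hN, hcf⟩ := hM.1
  exact isOpen_subgroupOf_of_isOpen_subgroupOf hle H'.isOpen hcf.isOpen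

/-- **IMAGE AGREEMENT from printed-shape inputs**: if `X` and `Y` have the same Galois image
(`∀ y ∃ g, aug_X g = aug_Y y`), `Δ^tp_X → Δ^tp_Y` is DENSE, every Y-index admits a minimal co-free
subgroup ([AbsTopI] §0 p. 8, standing hypothesis), and `d` is a converse cofinality choice, then
`Π^tp_Y = f(Π^tp_X)` modulo every X-side co-free kernel: `∀ H q, ∃ g, [toHat_Y q] = [f̂ toHat_X g]`.
Proof: move `q` into `Δ^tp_Y` by a `g₁` with the same Galois image; `y₁ · (d H)^{co-fr}` is an open
coset of `Δ^tp_Y`, so it contains some `f(g₂)`, `g₂ ∈ Δ^tp_X`; and `(d H)^{co-fr}` dies in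
`Q ⧸ X̂-kernel(H)`. [cite: MochizukiAbsTopI2012, §0 p.8] -/
theorem imageAgreement_of {X Y : TemperedCurve p} (E : DeCuspidalization X Y)
    (hrange : ∀ y : Y.PiTemp, ∃ g : X.PiTemp, X.aug g = Y.aug y)
    (hdense : DenseRange E.fDelta)
    (hmin : ∀ H' : CharOpenSubgroup Y.DeltaTemp, ∃ M, IsMinimalCofreeIn H'.toSubgroup M)
    (d : CharOpenSubgroup X.DeltaTemp → CharOpenSubgroup Y.DeltaTemp)
    (hd : ∀ H, coFreeKernel ((ContinuousMonoidHom.id Y.PiHat).comp Y.toHat) (d H).toSubgroup ≤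
      coFreeKernel (E.fHat.comp X.toHat) H.toSubgroup)
    (H : CharOpenSubgroup X.DeltaTemp) (q : Y.PiTemp) :
    ∃ g : X.PiTemp,
      ((((ContinuousMonoidHom.id Y.PiHat).comp Y.toHat) q : Y.PiHat) :
          CoFreeQuot (E.fHat.comp X.toHat) H.toSubgroup) =
        toCoFreeQuot (E.fHat.comp X.toHat) H.toSubgroup g := by
  -- Step 1: correct the Galois image
  obtain ⟨g₁, hg₁⟩ := hrange q
  have hy₁ : (E.f g₁)⁻¹ * q ∈ Y.DeltaTemp := by
    rw [TemperedCurve.DeltaTemp, MonoidHom.mem_ker, map_mul, map_inv]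
    change (Y.aug (E.f g₁))⁻¹ * Y.aug q = 1
    rw [E.aug_comp, hg₁, inv_mul_cancel]
  -- Step 2: the open subgroup `(d H)^{co-fr}` of `Δ^tp_Y` and the open coset of `y₁`
  obtain ⟨M, hM⟩ := hmin (d H)
  have hopen : IsOpen (((cofreeCore (d H).toSubgroup).subgroupOf Y.DeltaTemp :
      Subgroup Y.DeltaTemp) : Set Y.DeltaTemp) := isOpen_cofreeCore_subgroupOf (d H) hM
  let y₁ : Y.DeltaTemp := ⟨(E.f g₁)⁻¹ * q, hy₁⟩
  have hcoset : IsOpen ((fun z : Y.DeltaTemp => y₁ * z) ''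
      (((cofreeCore (d H).toSubgroup).subgroupOf Y.DeltaTemp : Subgroup Y.DeltaTemp) :
        Set Y.DeltaTemp)) := (Homeomorph.mulLeft y₁).isOpenMap _ hopen
  have hne : ((fun z : Y.DeltaTemp => y₁ * z) ''
      (((cofreeCore (d H).toSubgroup).subgroupOf Y.DeltaTemp : Subgroup Y.DeltaTemp) :
        Set Y.DeltaTemp)).Nonempty := ⟨y₁ * 1, 1, Subgroup.one_mem _, rfl⟩
  -- Step 3: density puts some `fDelta g₂` in the coset
  obtain ⟨g₂, hg₂⟩ := hdense.exists_mem_open hcoset hne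
  obtain ⟨m, hm, hmeq⟩ := hg₂
  -- `f g₂ = y₁ * m` with `m ∈ (d H)^{co-fr}`
  have hm' : (m : Y.PiTemp) ∈ cofreeCore (d H).toSubgroup := Subgroup.mem_subgroupOf.mp hm
  have hfg₂ : E.f (g₂ : X.PiTemp) = (E.f g₁)⁻¹ * q * (m : Y.PiTemp) := by
    have h := congrArg Subtype.val hmeq
    rw [DeCuspidalization.coe_fDelta_apply] at h
    exact h.symm
  -- Step 4: `q = f(g₁ g₂) m⁻¹`, and `m⁻¹` dies in `Q ⧸ X̂-kernel(H)`
  refine ⟨g₁ * g₂, ?_⟩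
  rw [toCoFreeQuot_apply, ← E.compat (g₁ * g₂), map_mul, hfg₂]
  change ((Y.toHat q : Y.PiHat) : CoFreeQuot (E.fHat.comp X.toHat) H.toSubgroup) =
    ((Y.toHat (E.f g₁ * ((E.f g₁)⁻¹ * q * m)) : Y.PiHat) : CoFreeQuot _ H.toSubgroup)
  have hsimp : E.f g₁ * ((E.f g₁)⁻¹ * q * (m : Y.PiTemp)) = q * m := by group
  rw [hsimp, map_mul, QuotientGroup.mk_mul]
  have hmker : ((Y.toHat (m : Y.PiTemp) : Y.PiHat) : CoFreeQuot (E.fHat.comp X.toHat) H.toSubgroup)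
      = 1 := by
    rw [QuotientGroup.eq_one_iff]
    exact hd H (apply_mem_coFreeKernel ((ContinuousMonoidHom.id Y.PiHat).comp Y.toHat)
      (d H).toSubgroup hm')
  rw [hmker, mul_one]

/-- **Prop 4.10 (iii) at the construction from printed-shape inputs**: (i) for `Y`, the two
cofinalities, same Galois image, density of `Δ^tp_X → Δ^tp_Y`, §0's minimal-co-free hypothesis for
the Y-indices, and openness of the descended maps. [cite: MochizukiAbsTopI2012, Prop 4.10 (iii) p.60] -/
theorem prop410iiiAt_of_rows' {X Y : TemperedCurve p} (E : DeCuspidalization X Y)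
    (hY : SelfCompletionAt Y) (hcof : CoFreeCofinalImAlong E)
    (hrange : ∀ y : Y.PiTemp, ∃ g : X.PiTemp, X.aug g = Y.aug y)
    (hdense : DenseRange E.fDelta)
    (hmin : ∀ H' : CharOpenSubgroup Y.DeltaTemp, ∃ M, IsMinimalCofreeIn H'.toSubgroup M)
    (hopen : ∀ H : CharOpenSubgroup X.DeltaTemp,
      IsOpenMap (fbar (ρX := E.fHat.comp X.toHat)
        (ρY := (ContinuousMonoidHom.id Y.PiHat).comp Y.toHat) (ΔX := X.DeltaTemp) (f := E.f)
        E.compat H)) :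
    Prop410iiiAt E := by
  classical
  choose d hd using hcof.1
  exact prop410iiiAt_of_rows E hY hcof (imageAgreement_of E hrange hdense hmin d hd) hopen

/-! ### Consistency: (iii) for `Δ^tp` forces the Δ-level density input -/

/-- **(iii) for `Δ^tp` forces `f(Δ^tp_X)` to be DENSE in `Δ^tp_Y`**: under `Prop410iiiDelta E kitX`
the closure of `f(Δ^tp_X)` in `Π^tp_Y` is `Δ^tp_Y` ("respectively, `Δ^tp_X → Δ^tp_Y`", [AbsTopI]
Prop 4.10 (iii) p. 60, read through Def 4.11 (i)(c)'s "dense"). [cite: MochizukiAbsTopI2012, Prop 4.10 (iii) p.60] -/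
theorem Prop410iiiDelta.topologicalClosure_map_f {X Y : TemperedCurve p} {E : DeCuspidalization X Y}
    {kitX : CoFreeQKit X Y.PiHat E.fHat} (h : Prop410iiiDelta E kitX) :
    (X.DeltaTemp.map E.f.toMonoidHom).topologicalClosure = Y.DeltaTemp := by
  obtain ⟨e, he, hΔ⟩ := h
  haveI : IsTopologicalGroup kitX.C := kitX.isTopologicalGroup
  rw [DLocObj.map_topologicalClosure_equiv, Subgroup.map_map] at hΔ
  have hcomp : e.toMulEquiv.toMonoidHom.comp kitX.η.toMonoidHom = E.f.toMonoidHom :=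
    MonoidHom.ext fun g => he g
  rwa [hcomp] at hΔ

/-- Under (iii) for `Δ^tp`: the restriction `Δ^tp_X → Δ^tp_Y` (`DeCuspidalization.fDelta`) has dense
range — the Δ-level density input of `imageAgreement_of` is implied by the node itself.
[cite: MochizukiAbsTopI2012, Prop 4.10 (iii) p.60] -/
theorem Prop410iiiDelta.denseRange_fDelta {X Y : TemperedCurve p} {E : DeCuspidalization X Y}
    {kitX : CoFreeQKit X Y.PiHat E.fHat} (h : Prop410iiiDelta E kitX) : DenseRange E.fDelta := by
  have hcl := Prop410iiiDelta.topologicalClosure_map_f h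
  intro y
  -- density inside the subspace `Δ^tp_Y`: `y ∈ closure (range fDelta)` iff
  -- `(y : Π^tp_Y) ∈ closure (val '' range fDelta) = closure (f '' Δ^tp_X) = Δ^tp_Y`
  rw [closure_subtype]
  have himg : (((↑) : Y.DeltaTemp → Y.PiTemp) '' Set.range E.fDelta) =
      ((X.DeltaTemp.map E.f.toMonoidHom : Subgroup Y.PiTemp) : Set Y.PiTemp) := by
    ext z
    constructor
    · rintro ⟨_, ⟨g, rfl⟩, rfl⟩
      exact ⟨(g : X.PiTemp), g.2, rfl⟩
    · rintro ⟨g, hg, rfl⟩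
      exact ⟨E.fDelta ⟨g, hg⟩, ⟨⟨g, hg⟩, rfl⟩, rfl⟩
  rw [himg, ← Subgroup.topologicalClosure_coe, hcl]
  exact y.2

end Literature.AnabelianGeometry.AbsoluteAnabelian.AbsTopI.Prop410
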